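import Mathlib
import Summits.CriticalPhenomena.CardyFormulaZ2.Theses.CardyComplexCone
import Literature.Probability.LatticeModels.SixVertexHeightModel

/-!
# Sketch — crux-ideate round 1, ideator 2, crux `ParafermionToSLESixFamilies` (stmt-CriticalPhenomena-11389)

First lemmas of the three idea cards (`Ideas/*.md`), stated over existing declarations only.
Nothing here is proved; the point is that each signature elaborates.

* Card A `iic-trace-flux-pairing` — `StripRigidity` (Riemann–Hilbert uniqueness with positive
  boundary data on the strip; pure complex analysis, provable now from Mathlib) and the
  `FluxPairingDichotomy` shape it feeds.
* Card B `caratheodory-net-slit-uniformity` — `FirstLemmaB : PrecompactFamilies → UniformPrecompact`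
  (the crux's second hypothesis is secretly uniform over all admissible data on a fixed carrier;
  diagonal/near-maximiser argument, provable now) and the shared a-priori bound `KoebeShadow`.
* AUTOPSIED third card `charge-reversal-vortex-positivity` (NOT filed; see NOTES.md `## Barrier notes`):
  `ChargeReversalCensus`, `BKWVertexWeights` record its exact finite content (at `q = 1` only the
  winding twist reverses the Baxter–Kelland–Wu charge of the explored arc, and the bulk vertex
  weights are the positive six-vertex weights `(1,1,√3)`); `TwoSidedEnvelope` is the self-normalised
  non-degeneracy target it aimed at; `BoundaryOneArmThird` is the imported exponent (card
  combinatorial-point-anchor P0) that cards A and B consume as stub EXP.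
-/

noncomputable section

namespace Summit.CriticalPhenomena.CardyFormulaZ2.Cruxes.ParafermionToSLESixFamilies.Sketch

open scoped Topology
open Filter MeasureTheory
open Literature.Probability.LatticeModels Literature.Probability.Percolation
open Literature.Probability.RandomPlanarGeometry

/-! ### Common vocabulary -/

/-- The spin-`1/3` vertex parafermion of discrete Dobrushin data `E` at the medial vertex `z`
(literally the `F δ z` of the crux, with `δ = E.δ`). [cite: DuminilCopinSmirnov2012Lattice, §8.3.1] -/
def obs (E : DiscreteDobrushin) (z : MedialVertex) : ℂ :=
  ∫ ω, passageSum (medialExploration E ω) E.δ (1 / 3) z ∂(bondPercolation (zdGraph 2) half)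

/-- Half-plane one-arm event at lattice scale `n` for bond percolation on `ℤ²`: the origin is joined
to sup-distance `≥ n` by configuration edges with both endpoints in the closed upper half-plane.
[cite: Kesten1987Scaling, §1] -/
def halfPlaneOneArm (n : ℕ) : Set (BondConfig (Site 2)) :=
  {ω | ∃ s : Site 2, (n : ℤ) ≤ max (|s 0|) (s 1) ∧
    (SimpleGraph.fromEdgeSet {e : Sym2 (Site 2) | e ∈ ω ∧ ∀ x ∈ e, (0 : ℤ) ≤ x 1}).Reachable
      (0 : Site 2) s}

/-- The half-plane one-arm probability `π₁⁺(1, n)` at `p = 1/2`. [cite: Kesten1987Scaling, §1] -/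
def boundaryOneArmProb (n : ℕ) : ℝ :=
  ((bondPercolation (zdGraph 2) half) (halfPlaneOneArm n)).toReal

/-! ### Card A — first lemma: strip rigidity -/

/-- **Strip rigidity** (the continuum Riemann–Hilbert uniqueness step, transported to the strip
`S = {0 < Im w < 1}` by the uniformising map `Φ : D → S`, `a ↦ -∞`, `b ↦ +∞`): a function holomorphic
in `S`, continuous on `S̄`, REAL and NON-NEGATIVE on both boundary lines, of exponential type
`< 2π` in `Re w`, is a non-negative constant. (Proof sketch: Schwarz reflection makes `u` entire
and `2i`-periodic, `u = v ∘ exp(π ·)` with `v` holomorphic on `ℂ ∖ {0}`; the growth bound leaves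
`v(ζ) = c₋₁ ζ⁻¹ + c₀ + c₁ ζ`, and positivity on the line `Im w = 1` (`ζ < 0`) kills `c_{±1}`.)
Applied to `u := f / (Φ')^{1/3}` it identifies every subsequential limit `f` of `δ^{-1/3} F_δ`
with boundary trace `e^{-iσW} × (positive density)` and growth `o(dist(·,{a,b})^{-7/3})` as
`c (Φ')^{1/3}`, `c ≥ 0`. [folklore] -/
def StripRigidity : Prop :=
  ∀ (u : ℂ → ℂ) (C a : ℝ), a < 2 * Real.pi →
    DifferentiableOn ℂ u {w : ℂ | 0 < w.im ∧ w.im < 1} →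
    ContinuousOn u {w : ℂ | 0 ≤ w.im ∧ w.im ≤ 1} →
    (∀ x : ℝ, ((u x).im = 0 ∧ 0 ≤ (u x).re) ∧
      ((u (x + Complex.I)).im = 0 ∧ 0 ≤ (u (x + Complex.I)).re)) →
    (∀ w : ℂ, 0 ≤ w.im → w.im ≤ 1 → ‖u w‖ ≤ C * Real.exp (a * |w.re|)) →
    ∃ c : ℝ, 0 ≤ c ∧ ∀ w : ℂ, 0 < w.im → w.im < 1 → u w = c

/-! ### Card B — first lemma: the crux's precompactness hypothesis is uniform over admissible data -/

/-- Hypothesis 2 of the crux (`ParafermionPrecompactFamilies`, rev 3, edge-guarded), verbatim. -/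
def PrecompactFamilies : Prop :=
  ∀ (D : DobrushinDomain) (Λ : ℝ → DiscreteDobrushin), (∀ δ, (Λ δ).Ω = D.carrier) →
    (∀ δ, (Λ δ).δ = δ) → (∀ᶠ δ in 𝓝[>] (0:ℝ), (Λ δ).IsZdAdmissible) →
    let F : ℝ → MedialVertex → ℂ := fun δ z =>
      ∫ ω, passageSum (medialExploration (Λ δ) ω) δ (1 / 3) z
        ∂(bondPercolation (zdGraph 2) half)
    ∀ K : Set ℂ, IsCompact K → K ⊆ D.carrier →
      (∃ C : ℝ, ∀ᶠ δ in 𝓝[>] (0:ℝ), ∀ z : MedialVertex, z ∈ (zdGraph 2).edgeSet →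
        medialPoint δ z ∈ K → ‖F δ z‖ ≤ C * δ ^ ((1:ℝ) / 3)) ∧
      (∀ ε > (0:ℝ), ∃ η > (0:ℝ), ∀ᶠ δ in 𝓝[>] (0:ℝ), ∀ z z' : MedialVertex,
        z ∈ (zdGraph 2).edgeSet → z' ∈ (zdGraph 2).edgeSet → medialPoint δ z ∈ K →
        medialPoint δ z' ∈ K → dist (medialPoint δ z) (medialPoint δ z') < η →
        ‖F δ z - F δ z'‖ ≤ ε * δ ^ ((1:ℝ) / 3))

/-- Local boundedness at scale `δ^{1/3}`, UNIFORM over all admissible discrete Dobrushin data with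
the given carrier (arbitrary arcs and marked points), for every carrier that admits at least one
eventually-admissible family. -/
def UniformPrecompact : Prop :=
  ∀ (D : DobrushinDomain),
    (∃ Λ : ℝ → DiscreteDobrushin, (∀ δ, (Λ δ).Ω = D.carrier) ∧ (∀ δ, (Λ δ).δ = δ) ∧
      ∀ᶠ δ in 𝓝[>] (0:ℝ), (Λ δ).IsZdAdmissible) →
    ∀ K : Set ℂ, IsCompact K → K ⊆ D.carrier →
      ∃ C : ℝ, ∀ᶠ δ in 𝓝[>] (0:ℝ), ∀ E : DiscreteDobrushin, E.Ω = D.carrier → E.δ = δ →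
        E.IsZdAdmissible → ∀ z : MedialVertex, z ∈ (zdGraph 2).edgeSet →
        medialPoint δ z ∈ K → ‖obs E z‖ ≤ C * δ ^ ((1:ℝ) / 3)

/-- **First lemma of card B** (provable now: pick, for each mesh, an admissible datum and a lattice
edge nearly maximising `‖obs E z‖` over `K` — the supremum is `≤ 2` since a medial vertex is passed
at most twice — and feed that diagonal family to the hypothesis). [folklore] -/
def FirstLemmaB : Prop := PrecompactFamilies → UniformPrecompact

/-! ### Shared hard stub of cards A and B: Koebe's shadow -/

/-- **Koebe's shadow** (the master a-priori inequality `UB`): for every admissible discrete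
Dobrushin datum and every lattice edge, the parafermion is at most a universal constant times the
half-plane one-arm probability at the edge's depth (lattice distance to the complement of the
domain). Consistent with the conjectured limit `c (Φ')^{1/3}` by Koebe's `|Φ'| ≤ 2/dist(·, ∂D)`;
violated maximally by the plaquette kernels of `halfCRSolutions`, hence outside that technique class.
[cite: DuminilCopinSmirnov2012Lattice, Conjecture 8.7] -/
def KoebeShadow : Prop :=
  ∃ C : ℝ, ∀ E : DiscreteDobrushin, E.IsZdAdmissible → ∀ z : MedialVertex, z ∈ (zdGraph 2).edgeSet →
    ‖obs E z‖ ≤ C * boundaryOneArmProb ⌊Metric.infDist (medialPoint E.δ z) E.Ωᶜ / E.δ⌋₊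

/-! ### Card C — first lemma: two-sided envelope at the boundary one-arm scale -/

/-- The exponent input every line needs (card combinatorial-point-anchor P0, from the exact boundary
passage law on the `ℤ²` strip + RSW transfer): `π₁⁺(1, n) ≍ n^{-1/3}` two-sidedly.
[cite: Zhou2024SLE6BondZ2, §1.4 eq. (10) (claimed input, attributed to Ikhlef–Ponsaing 2012)] -/
def BoundaryOneArmThird : Prop :=
  ∃ c C : ℝ, 0 < c ∧ ∀ n : ℕ, 1 ≤ n →
    c * (n : ℝ) ^ (-(1:ℝ) / 3) ≤ boundaryOneArmProb n ∧ boundaryOneArmProb n ≤ C * (n : ℝ) ^ (-(1:ℝ) / 3)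

/-- **Two-sided envelope** (card C's target, self-normalised non-degeneracy): along every
discretisation family of every Dobrushin domain whose arcs and marked points converge, the
parafermion on compacts is two-sidedly comparable to the half-plane one-arm probability at scale
`1/δ`. With `BoundaryOneArmThird` it excludes the zero world of the crux and makes `δ^{1/3}` the
right envelope; its lower half is what no positive-quantity (RSW) technology reaches.
[cite: DuminilCopinSmirnov2012Lattice, Conjecture 8.7] -/
def TwoSidedEnvelope : Prop :=
  ∀ (D : DobrushinDomain) (Λ : ℝ → DiscreteDobrushin), (∀ δ, (Λ δ).Ω = D.carrier) →
    (∀ δ, (Λ δ).δ = δ) →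
    Tendsto (fun δ : ℝ => Metric.hausdorffEDist (Λ δ).arcA (D.arc 0)) (𝓝[>] (0:ℝ)) (𝓝 0) →
    Tendsto (fun δ : ℝ => Metric.hausdorffEDist (Λ δ).arcB (D.arc 1)) (𝓝[>] (0:ℝ)) (𝓝 0) →
    Tendsto (fun δ : ℝ => Metric.hausdorffEDist (medialPoint δ '' (Λ δ).zdABEdges) {D.pt 0, D.pt 1})
      (𝓝[>] (0:ℝ)) (𝓝 0) →
    (∀ᶠ δ in 𝓝[>] (0:ℝ), (Λ δ).IsZdAdmissible) →
    ∀ K : Set ℂ, IsCompact K → K ⊆ D.carrier →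
      ∃ c C : ℝ, 0 < c ∧ ∀ᶠ δ in 𝓝[>] (0:ℝ), ∀ z : MedialVertex, z ∈ (zdGraph 2).edgeSet →
        medialPoint δ z ∈ K →
        c * boundaryOneArmProb ⌊1 / δ⌋₊ ≤ ‖obs (Λ δ) z‖ ∧
          ‖obs (Λ δ) z‖ ≤ C * boundaryOneArmProb ⌊1 / δ⌋₊

/-! ### Card C — census and vertex weights behind the charge-reversal dictionary -/

/-- **Charge-reversal census** (card C, first lemma (a)): the parafermionic spin
`σ(q) = 1 - (2/π) arccos(√q/2)` [cite: DuminilCopinSmirnov2012Lattice, Proposition 8.6] equals the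
loop-fugacity angle `ẽ(q) = (1/π) arccos(√q/2)` (loop weight `√q = 2 cos(π ẽ)`) exactly at `q = 1`:
only for bond percolation does the winding twist `e^{-iσW(a→z)}` reverse the Baxter–Kelland–Wu
charge of the explored arc. [folklore] -/
def ChargeReversalCensus : Prop :=
  ∀ q : ℝ, 0 ≤ q → q ≤ 4 →
    (1 - 2 / Real.pi * Real.arccos (Real.sqrt q / 2) = 1 / Real.pi * Real.arccos (Real.sqrt q / 2) ↔
      q = 1)

/-- **BKW vertex weights at `ẽ = 1/3`** (card C, first lemma (b)): with the turn phase `e^{±iπ/12}`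
per quarter turn of an oriented strand, a medial vertex with ADJACENT in-arrows admits one turning
pairing, of weight `e^{iπ/12} e^{-iπ/12} = 1`, and one with OPPOSITE in-arrows admits two, of total
weight `2 cos(π/6) = √3`; so the oriented-loop expansion of critical bond percolation on `ℤ²` is the
six-vertex model `(a, b, c) = (1, 1, √3)` with `Δ = (a² + b² - c²)/(2ab) = -1/2` and POSITIVE
interior weights (`SixVertex.sixVertexTensor 1 1 (√3)` in the tree module `SixVertexHeightModel`). [folklore] -/
def BKWVertexWeights : Prop :=
  Complex.exp (Complex.I * (Real.pi / 12)) * Complex.exp (-(Complex.I * (Real.pi / 12))) = 1 ∧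
  Complex.exp (Complex.I * (Real.pi / 6)) + Complex.exp (-(Complex.I * (Real.pi / 6))) =
    ((Real.sqrt 3 : ℝ) : ℂ) ∧
  ((1:ℝ) ^ 2 + (1:ℝ) ^ 2 - Real.sqrt 3 ^ 2) / (2 * 1 * 1) = -(1 / 2 : ℝ) ∧
  (∀ e n w s : Bool, 0 ≤ Literature.Probability.LatticeModels.SixVertex.sixVertexTensor (1:ℝ) 1 (Real.sqrt 3) e n w s)

/-! ### The dichotomy card A's pairing produces (shape only) -/

/-- Card A's output, GIVEN `KoebeShadow`: the crux's hypothesis 2 already forces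
`π₁⁺(1, ⌊1/δ⌋) = O(δ^{1/3})` (world Z3 excluded) — stated here as the implication to be proved by
the Green-identity pairing against the IIC-normalised boundary trace. [cite: DuminilCopin2012Parafermion, Proposition 4] -/
def FluxPairingUpperExponent : Prop :=
  KoebeShadow → PrecompactFamilies →
    ∃ C : ℝ, ∀ᶠ δ in 𝓝[>] (0:ℝ), boundaryOneArmProb ⌊1 / δ⌋₊ ≤ C * δ ^ ((1:ℝ) / 3)

end Summit.CriticalPhenomena.CardyFormulaZ2.Cruxes.ParafermionToSLESixFamilies.Sketch
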